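import Mathlib
import Summits.MatrixMultiplication.MatrixMultiplication.Theses.SemilatticeSTPP

/-!
# Line `localCapacity` of crux `SemilatticeSTPP.Thesis` (stmt-MatrixMultiplication-5969):
# the capacity stub READ BACK from the crux, and its non-vacuity above `ε = 1`

The registered skeleton `Cruxes/Thesis/Lines/localCapacity.lean` proves the crux `Thesis` (X_M) from two
stubs: `stub_localDesignSound` (letters + local kill ⇒ a monoid-TPP family in the power host `Fin n → C`)
and `stub_capacityDesign` (for every `ε > 0` a locally-killed word design over some finite commutative
Clifford base `C` whose value beats `|C|^n` at exponent `(2+ε)/3`).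

This file records the converse bookkeeping, which fixes the LOGICAL STATUS of the line:

* `capacityBodyAt_of_thesisBodyAt` — at every exponent, a witness of the ∃-body of `Thesis` IS a capacity
  design with ONE coordinate (`n = 1`, base `C := M`, letters := the blocks, words := single letters,
  `row i 0 := i`): the same-letter iff is the matched part of the global iff, and the local kill at the unique
  coordinate is exactly the unmatched part (block indices not all equal ⇒ the global iff's right-hand side is
  false).  Hence `capacityDesign_of_thesis : Thesis → (signature of stub_capacityDesign)`; together with the
  skeleton's `Thesis_of` the capacity stub is EQUIVALENT to the crux — the line is a reformulation (product /
  word designs as a search space with local certificates), not a strict strengthening, and it cannot die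
  while the crux lives.
* `thesisBodyAt_of_one_lt`, `capacityDesign_of_one_lt` — read-back / non-vacuity: for every `ε > 1` the body
  holds (host `ℤ/2` written multiplicatively, one block `⟨1,2,1⟩`, `α(t) = t`, `β(t') = t'`, `γ = 0`;
  `2 < 2^{(2+ε)/3}` iff `ε > 1`), extending the landed boundary instance `thesisBody_at_two`
  (`Theorems/Thesis/Negative/SemilatticeSTPPVolumeFloor.lean`).  Below `ε = 1` a single block never suffices
  in a commutative host (volume floor / packing bounds); the USP read-back (CKSU 2005 Prop 18 + Thm 33 over
  `Cyc_ℓ`) reaches `ε ≈ 0.48`, and `ε → 0` is the open bet.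

All statements are written against the route declaration `…Theses.SemilatticeSTPP.Thesis` and the stub
signature VERBATIM (no new definitions).  Mathlib + the route file only; sorry-free.
-/

set_option linter.dupNamespace false
-- (single-conjunct summit: the namespace repeats `MatrixMultiplication`)

namespace Summit.MatrixMultiplication.MatrixMultiplication.Theorems.SemilatticeSTPPThesis

open Summit.MatrixMultiplication.MatrixMultiplication.Theses.SemilatticeSTPP

/-- **Read-back at a fixed exponent.**  A witness of the ∃-body of `Thesis` at exponent `τ` (any real) is a
capacity design in the sense of `stub_capacityDesign` at the same exponent, with one coordinate: base
`C := M`, `k := p` letters = the blocks, `L := p` words of length `n := 1`, `row i 0 := i`.  The same-letter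
iff is the global iff on matched block indices; the local kill at coordinate `0` is the global iff on block
indices not all equal; the value is unchanged (`∏ over Fin 1`, `|C|^1`). [folklore] -/
theorem capacityBodyAt_of_thesisBodyAt (τ : ℝ)
    (h : ∃ (M : Type) (_ : CommMonoid M) (_ : Fintype M),
      (∀ x : M, ∃ y : M, x * y * x = x) ∧ ∃ (p : ℕ) (a b c : Fin p → ℕ)
      (α : (Σ i, Fin (a i) × Fin (b i)) → M) (β : (Σ i, Fin (b i) × Fin (c i)) → M)
      (γ : (Σ i, Fin (a i) × Fin (c i)) → M),
      (∀ x y z, α x * β y = γ z ↔ (z.1 = x.1 ∧ x.1 = y.1 ∧ (z.2.1 : ℕ) = x.2.1 ∧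
        (x.2.2 : ℕ) = y.2.1 ∧ (z.2.2 : ℕ) = y.2.2)) ∧
      (Fintype.card M : ℝ) < ∑ i, ((a i * b i * c i : ℕ) : ℝ) ^ τ) :
    ∃ (C : Type) (_ : CommMonoid C) (_ : Fintype C),
      (∀ x : C, ∃ y : C, x * y * x = x) ∧
      ∃ (k : ℕ) (ag bg cg : Fin k → ℕ)
        (αg : (Σ σ : Fin k, Fin (ag σ) × Fin (bg σ)) → C)
        (βg : (Σ σ : Fin k, Fin (bg σ) × Fin (cg σ)) → C)
        (γg : (Σ σ : Fin k, Fin (ag σ) × Fin (cg σ)) → C)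
        (L n : ℕ) (row : Fin L → Fin n → Fin k),
        (∀ (σ : Fin k) (s s' : Fin (ag σ)) (t t' : Fin (bg σ)) (u u' : Fin (cg σ)),
            αg ⟨σ, (s, t)⟩ * βg ⟨σ, (t', u)⟩ = γg ⟨σ, (s', u')⟩ ↔ (s' = s ∧ t = t' ∧ u' = u)) ∧
        (∀ i j l : Fin L, (i ≠ j ∨ j ≠ l) → ∃ c : Fin n,
            ∀ (s : Fin (ag (row i c))) (t : Fin (bg (row i c))) (t' : Fin (bg (row j c)))
              (u : Fin (cg (row j c))) (s' : Fin (ag (row l c))) (u' : Fin (cg (row l c))),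
              αg ⟨row i c, (s, t)⟩ * βg ⟨row j c, (t', u)⟩ ≠ γg ⟨row l c, (s', u')⟩) ∧
        (Fintype.card C : ℝ) ^ n <
          ∑ i : Fin L, (((∏ c, ag (row i c)) * (∏ c, bg (row i c)) * (∏ c, cg (row i c)) : ℕ) : ℝ) ^
            τ := by
  obtain ⟨M, instM, instF, hreg, p, a, b, c, α, β, γ, htpp, hval⟩ := h
  refine ⟨M, instM, instF, hreg, p, a, b, c, α, β, γ, p, 1, fun i _ => i, ?_, ?_, ?_⟩
  · -- same-letter iff = the matched part of the global iff
    intro σ s s' t t' u u'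
    rw [htpp]
    simp [Fin.ext_iff]
  · -- local kill at the unique coordinate = the unmatched part of the global iff
    intro i j l hne
    refine ⟨0, ?_⟩
    intro s t t' u s' u' heq
    rw [htpp] at heq
    obtain ⟨h1, h2, -⟩ := heq
    simp only at h1 h2
    rcases hne with h | h
    · exact h h2
    · exact h (h1.trans h2).symm
  · -- the value: products over `Fin 1`, `|C| ^ 1`
    simpa using hval

/-- **The capacity stub follows from the crux.**  `Thesis` implies the signature of the registered stub
`stub_capacityDesign` of line `localCapacity` verbatim (one-coordinate designs, `capacityBodyAt_of_thesisBodyAt`).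
With the skeleton's `Thesis_of` (stub ⇒ crux via `stub_localDesignSound`) the stub is equivalent to the crux.
[folklore] -/
theorem capacityDesign_of_thesis :
    Summit.MatrixMultiplication.MatrixMultiplication.Theses.SemilatticeSTPP.Thesis →
    ∀ ε : ℝ, 0 < ε → ∃ (C : Type) (_ : CommMonoid C) (_ : Fintype C),
      (∀ x : C, ∃ y : C, x * y * x = x) ∧
      ∃ (k : ℕ) (ag bg cg : Fin k → ℕ)
        (αg : (Σ σ : Fin k, Fin (ag σ) × Fin (bg σ)) → C)
        (βg : (Σ σ : Fin k, Fin (bg σ) × Fin (cg σ)) → C)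
        (γg : (Σ σ : Fin k, Fin (ag σ) × Fin (cg σ)) → C)
        (L n : ℕ) (row : Fin L → Fin n → Fin k),
        (∀ (σ : Fin k) (s s' : Fin (ag σ)) (t t' : Fin (bg σ)) (u u' : Fin (cg σ)),
            αg ⟨σ, (s, t)⟩ * βg ⟨σ, (t', u)⟩ = γg ⟨σ, (s', u')⟩ ↔ (s' = s ∧ t = t' ∧ u' = u)) ∧
        (∀ i j l : Fin L, (i ≠ j ∨ j ≠ l) → ∃ c : Fin n,
            ∀ (s : Fin (ag (row i c))) (t : Fin (bg (row i c))) (t' : Fin (bg (row j c)))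
              (u : Fin (cg (row j c))) (s' : Fin (ag (row l c))) (u' : Fin (cg (row l c))),
              αg ⟨row i c, (s, t)⟩ * βg ⟨row j c, (t', u)⟩ ≠ γg ⟨row l c, (s', u')⟩) ∧
        (Fintype.card C : ℝ) ^ n <
          ∑ i : Fin L, (((∏ c, ag (row i c)) * (∏ c, bg (row i c)) * (∏ c, cg (row i c)) : ℕ) : ℝ) ^
            ((2 + ε) / 3) :=
  fun hX ε hε => capacityBodyAt_of_thesisBodyAt ((2 + ε) / 3) (hX ε hε)

/-- **The ∃-body of `Thesis` holds for every `ε > 1`** (read-back / non-vacuity, extending the landed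
`thesisBody_at_two`): host `ℤ/2` written multiplicatively (an abelian group: commutative, every element
regular), one block `⟨1,2,1⟩`, `α(t) = t`, `β(t') = t'`, `γ = 0`, so `α(t)·β(t') = γ ⟺ t = t'`, and
`|M| = 2 < 2^{(2+ε)/3}` exactly when `ε > 1`. [folklore] -/
theorem thesisBodyAt_of_one_lt (ε : ℝ) (hε : 1 < ε) : ∃ (M : Type) (_ : CommMonoid M) (_ : Fintype M),
    (∀ x : M, ∃ y : M, x * y * x = x) ∧ ∃ (p : ℕ) (a b c : Fin p → ℕ)
    (α : (Σ i, Fin (a i) × Fin (b i)) → M) (β : (Σ i, Fin (b i) × Fin (c i)) → M)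
    (γ : (Σ i, Fin (a i) × Fin (c i)) → M),
    (∀ x y z, α x * β y = γ z ↔ (z.1 = x.1 ∧ x.1 = y.1 ∧ (z.2.1 : ℕ) = x.2.1 ∧ (x.2.2 : ℕ) = y.2.1 ∧
      (z.2.2 : ℕ) = y.2.2)) ∧
    (Fintype.card M : ℝ) < ∑ i, ((a i * b i * c i : ℕ) : ℝ) ^ ((2 + ε) / 3) := by
  refine ⟨Multiplicative (ZMod 2), inferInstance, inferInstance, ?_, 1, fun _ => 1, fun _ => 2,
    fun _ => 1, fun x => Multiplicative.ofAdd ((x.2.2 : ℕ) : ZMod 2),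
    fun y => Multiplicative.ofAdd ((y.2.1 : ℕ) : ZMod 2), fun _ => 1, ?_, ?_⟩
  · intro x; exact ⟨x⁻¹, by group⟩
  · decide
  · simp only [Finset.univ_unique, Finset.sum_singleton]
    norm_num
    have h1 : (1 : ℝ) < (2 + ε) / 3 := by linarith
    have : (2 : ℝ) ^ (1 : ℝ) < (2 : ℝ) ^ ((2 + ε) / 3) :=
      Real.rpow_lt_rpow_of_exponent_lt (by norm_num) h1
    simpa using this

/-- **Non-vacuity of the capacity stub above `ε = 1`.**  For every `ε > 1` the ∃-body of the registered stub
`stub_capacityDesign` holds (the one-letter design `⟨1,2,1⟩` over `C = ℤ/2`, `k = L = n = 1`, read back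
through `capacityBodyAt_of_thesisBodyAt`).  The open content of the stub is `0 < ε ≤ 1` (USP read-back:
`ε ≳ 0.48`; semilattice / growing bases: open). [folklore] -/
theorem capacityDesign_of_one_lt (ε : ℝ) (hε : 1 < ε) :
    ∃ (C : Type) (_ : CommMonoid C) (_ : Fintype C),
      (∀ x : C, ∃ y : C, x * y * x = x) ∧
      ∃ (k : ℕ) (ag bg cg : Fin k → ℕ)
        (αg : (Σ σ : Fin k, Fin (ag σ) × Fin (bg σ)) → C)
        (βg : (Σ σ : Fin k, Fin (bg σ) × Fin (cg σ)) → C)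
        (γg : (Σ σ : Fin k, Fin (ag σ) × Fin (cg σ)) → C)
        (L n : ℕ) (row : Fin L → Fin n → Fin k),
        (∀ (σ : Fin k) (s s' : Fin (ag σ)) (t t' : Fin (bg σ)) (u u' : Fin (cg σ)),
            αg ⟨σ, (s, t)⟩ * βg ⟨σ, (t', u)⟩ = γg ⟨σ, (s', u')⟩ ↔ (s' = s ∧ t = t' ∧ u' = u)) ∧
        (∀ i j l : Fin L, (i ≠ j ∨ j ≠ l) → ∃ c : Fin n,
            ∀ (s : Fin (ag (row i c))) (t : Fin (bg (row i c))) (t' : Fin (bg (row j c)))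
              (u : Fin (cg (row j c))) (s' : Fin (ag (row l c))) (u' : Fin (cg (row l c))),
              αg ⟨row i c, (s, t)⟩ * βg ⟨row j c, (t', u)⟩ ≠ γg ⟨row l c, (s', u')⟩) ∧
        (Fintype.card C : ℝ) ^ n <
          ∑ i : Fin L, (((∏ c, ag (row i c)) * (∏ c, bg (row i c)) * (∏ c, cg (row i c)) : ℕ) : ℝ) ^
            ((2 + ε) / 3) :=
  capacityBodyAt_of_thesisBodyAt ((2 + ε) / 3) (thesisBodyAt_of_one_lt ε hε)

end Summit.MatrixMultiplication.MatrixMultiplication.Theorems.SemilatticeSTPPThesis
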